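import Summits.AtomisticToContinuum.Crystallization.Theorems.FrustratedLawDichotomyStrainedPatchHomValueT2SoundA

/-!
# (I1) part A2 — ★ `mem_coeffT`: soundness of the TIGHT DISPATCHER of the G5′ value leaf (`…HomValueT2Kit.coeffT`) in the exact statement shape of
# `…HomCurvDispatch2.mem_coeffFI2`, from the endpoint hulls of part A (`…HomValueT2SoundA.mem_alphaLJHull / mem_betaLJHull`), the regime identities of
# `…HomCurvRegime3` and the clipped `w`-interval `wOf`
# (27623 `(H) HomFloor`, hcp half; decomp-a2c hand-1 g41; first instalment of the soundness theorem `valueLeafT2_sound`, FINDING-hand-1-g41 §6 (R3)).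

Regimes: bump (`Q.hi < 64/25·SC` ⇒ `ρ < 8/5`: `α = alphaB`, `β = betaB`), Lennard-Jones (`65/25·SC ≤ Q.lo`, `Q.hi < 9·SC` ⇒ `8/5 < ρ < 3`), the junction
hull (bump branch on the clipped `w ≤ 2`), and the fallback `coeffFI2` (`Q.hi ≥ 9·SC`).  No definitions; 0 sorry; standard axioms; no instances / notation /
`#eval`.  `--supports stmt-AtomisticToContinuum-27623`.
-/

noncomputable section

namespace Summit.AtomisticToContinuum.Crystallization.Theorems.FrustratedLawDichotomyStrainedPatchHomValueT2Kit

open Literature.Analysis.ValidatedNumerics.Numerics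
open Summit.AtomisticToContinuum.Crystallization.Theorems.FrustratedLawDichotomySchurCut (effPot w₄₅ ω₄)
open Summit.AtomisticToContinuum.Crystallization.Theorems.FrustratedLawDichotomyStrainedPatchHomForceKit (phiFI mem_phiFI)
open Summit.AtomisticToContinuum.Crystallization.Theorems.FrustratedLawDichotomyStrainedPatchHomCurvCoeff
  (coeffFI2 alphaLJFI mem_alphaLJFI wFI mem_wFI rhoFI mem_rhoFI bumpS54FI mem_bumpS54FI mem_coeffFI2)
open Summit.AtomisticToContinuum.Crystallization.Theorems.FrustratedLawDichotomyStrainedPatchHomCurvCoeff3 (bumpTFI mem_bumpTFI k75 mem_k75 inv_sq_pow)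
open Summit.AtomisticToContinuum.Crystallization.Theorems.FrustratedLawDichotomyStrainedPatchHomCurvRegime3
  (alphaLJ betaLJ alphaB betaB bumpT bumpS alphaTrue_eq_lj betaTrue_eq_lj alphaTrue_eq_bump betaTrue_eq_bump)
open Summit.AtomisticToContinuum.Crystallization.Theorems.FrustratedLawDichotomyStrainedPatchTaylorLeaves (junctions)

/-! ## §4. ★ Soundness of the tight dispatcher `coeffT` -/

/-- `alphaLJFI J = some _` forces `0 < J.lo` (the division guard). [formal bookkeeping] -/
theorem lo_pos_of_alphaLJFI {J : FI} {A : FI} (h : alphaLJFI J = some A) : 0 < J.lo := by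
  unfold alphaLJFI at h
  by_contra hneg
  have : FI.divPos (FI.ofInt 1) J = none := by unfold FI.divPos; rw [if_neg hneg]
  rw [this] at h
  exact absurd h (by simp)

/-- `alphaLJHull Q = some _` forces `0 < Q.lo`. [formal bookkeeping] -/
theorem lo_pos_of_alphaLJHull {Q A : FI} (h : alphaLJHull Q = some A) : 0 < Q.lo := by
  unfold alphaLJHull at h
  cases h1 : alphaLJFI (thin Q.lo) with
  | none => rw [h1] at h; exact absurd h (by simp)
  | some a1 =>
    have := lo_pos_of_alphaLJFI h1
    simpa [thin] using this

/-- The (possibly clipped) `w`-interval contains `w = 5ρ/4` (clipping allowed when `w ≤ 2`). [folklore] -/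
theorem mem_wOf {ρ : ℝ} (hρ : 0 ≤ ρ) {Q : FI} (hq : FI.mem (ρ ^ 2) Q) {clip : Bool} (hc : clip = true → 5 * ρ / 4 ≤ 2) :
    FI.mem (5 * ρ / 4) (wOf Q clip) := by
  have hW : FI.mem (5 * ρ / 4) (wFI (rhoFI Q)) := mem_wFI (mem_rhoFI hρ hq)
  unfold wOf
  cases clip with
  | false => simpa using hW
  | true =>
    have h2 := hc rfl
    obtain ⟨h1, h3⟩ := hW
    simp only [ite_true]
    refine ⟨?_, ?_⟩
    · push_cast
      exact (min_le_left _ _).trans h1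
    · push_cast
      refine le_min h3 ?_
      have hS := SC_pos
      nlinarith

/-- `alphaLJ ρ = 14 (ρ²)⁻⁸ − 8 (ρ²)⁻⁵`. [arithmetic] -/
theorem alphaLJ_eq_sq (ρ : ℝ) : alphaLJ ρ = 14 * ((ρ ^ 2)⁻¹) ^ 8 - 8 * ((ρ ^ 2)⁻¹) ^ 5 := by
  rw [alphaLJ, inv_sq_pow, inv_sq_pow]

/-- The bump correction of `β`: `(5/4·S(w))·3/160 = (3/128)·S(w)` enclosed. [folklore] -/
theorem mem_betaCorr {w : ℝ} {W : FI} (h : FI.mem w W) : FI.mem (3 / 128 * bumpS w) (((bumpS54FI W).mulInt 3).divNat 160) := by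
  have := FI.mem_divNat (FI.mem_mulInt (mem_bumpS54FI h) 3) (n := 160) (by norm_num)
  push_cast at this
  rw [bumpS]
  convert this using 1
  ring

/-- The bump correction of `α`: `(75/2048)·T(w)` enclosed. [folklore] -/
theorem mem_alphaCorr {w : ℝ} {W : FI} (h : FI.mem w W) : FI.mem (75 / 2048 * bumpT w) (k75 (bumpTFI W)) := mem_k75 (mem_bumpTFI h)

/-- ★★★ **SOUNDNESS OF THE TIGHT DISPATCHER**: for every `ρ > 0` off the junction radii with `ρ² ∈ Q`, `coeffT Q = some (A, B)` encloses
`α(ρ) = (W₄₅″(ρ) − W₄₅′(ρ)/ρ)/ρ² ∈ A` and `β(ρ) = W₄₅′(ρ)/ρ ∈ B` — the exact statement shape of `…HomCurvDispatch2.mem_coeffFI2`. [folklore chaining] -/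
theorem mem_coeffT {ρ : ℝ} (h0 : 0 < ρ) (hJ : ρ ∉ junctions) {Q : FI} (hq : FI.mem (ρ ^ 2) Q) {AB : FI × FI} (h : coeffT Q = some AB) :
    FI.mem ((deriv (deriv (effPot w₄₅ ω₄ (3 / 400))) ρ - deriv (effPot w₄₅ ω₄ (3 / 400)) ρ / ρ) / ρ ^ 2) AB.1 ∧
      FI.mem (deriv (effPot w₄₅ ω₄ (3 / 400)) ρ / ρ) AB.2 := by
  unfold coeffT at h
  by_cases h9 : 9 * (SC : ℤ) ≤ Q.hi
  · rw [if_pos h9] at h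
    exact mem_coeffFI2 h0 hJ hq h
  rw [if_neg h9] at h
  cases ha : alphaLJHull Q with
  | none => rw [ha] at h; exact absurd h (by simp)
  | some a =>
  cases hb : betaLJHull Q with
  | none => rw [ha, hb] at h; exact absurd h (by simp)
  | some b =>
  rw [ha, hb] at h
  simp only at h
  have hlo : 0 < Q.lo := lo_pos_of_alphaLJHull ha
  have mA : FI.mem (alphaLJ ρ) a := by rw [alphaLJ_eq_sq]; exact mem_alphaLJHull hlo hq ha
  have eB : betaLJ ρ = ((ρ ^ 2)⁻¹) ^ 4 - ((ρ ^ 2)⁻¹) ^ 7 := by rw [betaLJ, inv_sq_pow, inv_sq_pow]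
  have mB : FI.mem (betaLJ ρ) b := by rw [eB]; exact mem_betaLJHull hlo hq hb
  -- `ρ < 3` from `Q.hi < 9·SC`
  have hρ3 : ρ < 3 := by
    have h9' : (Q.hi : ℝ) < 9 * SC := by exact_mod_cast (not_le.mp h9)
    have hh : ρ ^ 2 * SC ≤ Q.hi := hq.2
    have : ρ ^ 2 < 9 := by nlinarith [SC_pos]
    nlinarith
  by_cases hbump : Q.hi < qc 64 25
  · -- bump regime
    rw [if_pos hbump] at h
    simp only [Option.some.injEq] at h
    subst h
    have hρ85 : ρ < 8 / 5 := by
      have h1 : (Q.hi : ℝ) ≤ 64 * SC / 25 := le_of_le_qc (n := 64) (d := 25) (by norm_num) hbump.le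
      have h1' : (Q.hi : ℝ) < 64 * SC / 25 ∨ (Q.hi : ℝ) ≤ 64 * SC / 25 := Or.inr h1
      have hh : ρ ^ 2 * SC ≤ Q.hi := hq.2
      have hlt : (Q.hi : ℤ) < qc 64 25 := hbump
      have hlt' : (Q.hi : ℝ) + 1 ≤ qc 64 25 := by exact_mod_cast hlt
      have hqc : ((qc 64 25 : ℤ) : ℝ) ≤ 64 * SC / 25 := le_of_le_qc (n := 64) (d := 25) (by norm_num) le_rfl
      have : ρ ^ 2 * SC < 64 * SC / 25 := by linarith
      have : ρ ^ 2 < 64 / 25 := by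
        rw [lt_div_iff₀ (by norm_num : (0:ℝ) < 25)]
        have := SC_pos
        nlinarith
      nlinarith
    have hw : FI.mem (5 * ρ / 4) (wOf Q false) := mem_wOf h0.le hq (by simp)
    refine ⟨?_, ?_⟩
    · rw [alphaTrue_eq_bump h0 hρ85, alphaB]
      exact FI.mem_sub mA (mem_alphaCorr hw)
    · rw [betaTrue_eq_bump h0 hρ85, betaB]
      exact FI.mem_sub mB (mem_betaCorr hw)
  rw [if_neg hbump] at h
  by_cases hlj : qc 65 25 ≤ Q.lo
  · -- Lennard-Jones regime
    rw [if_pos hlj] at h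
    simp only [Option.some.injEq] at h
    subst h
    have hρ85 : 8 / 5 < ρ := by
      have h1 := lt_of_qc_le (n := 65) (d := 25) (by norm_num) hlj
      have hh : (Q.lo : ℝ) ≤ ρ ^ 2 * SC := hq.1
      have hS : (100 : ℝ) ≤ SC := by norm_num [SC]
      have : 64 / 25 * SC < ρ ^ 2 * SC := by push_cast at h1; nlinarith
      have : 64 / 25 < ρ ^ 2 := lt_of_mul_lt_mul_right this SC_pos.le
      nlinarith
    exact ⟨by rw [alphaTrue_eq_lj hρ85 hρ3]; exact mA, by rw [betaTrue_eq_lj hρ85 hρ3]; exact mB⟩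
  · -- junction hull
    rw [if_neg hlj] at h
    simp only [Option.some.injEq] at h
    subst h
    rcases Summit.AtomisticToContinuum.Crystallization.Theorems.FrustratedLawDichotomyStrainedPatchHomCurvRegime.regime_cases h0 hJ with hb' | hl' | hw' | hf'
    · have hw : FI.mem (5 * ρ / 4) (wOf Q true) := mem_wOf h0.le hq (fun _ => by linarith [hb'.2])
      refine ⟨FI.mem_hull_right ?_ _, FI.mem_hull_right ?_ _⟩
      · rw [alphaTrue_eq_bump h0 hb'.2, alphaB]; exact FI.mem_sub mA (mem_alphaCorr hw)
      · rw [betaTrue_eq_bump h0 hb'.2, betaB]; exact FI.mem_sub mB (mem_betaCorr hw)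
    · exact ⟨FI.mem_hull_left (by rw [alphaTrue_eq_lj hl'.1 hl'.2]; exact mA) _,
        FI.mem_hull_left (by rw [betaTrue_eq_lj hl'.1 hl'.2]; exact mB) _⟩
    · exact absurd hρ3 (not_lt.2 hw'.1.le)
    · exact absurd hρ3 (by linarith [hf'])

end Summit.AtomisticToContinuum.Crystallization.Theorems.FrustratedLawDichotomyStrainedPatchHomValueT2Kit
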